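import Summits.QuantumFields.YangMills.Theorems.BalabanUVNodesN11TStepInnerIntegrandGraphIntegrable
import Summits.QuantumFields.YangMills.Theorems.BalabanUVNodesN11TkOpMeasurable

/-!
# DAG node N11 — (O3′) ON THE NOSE IN THE STAGE-13 LETTERS WITHOUT THE `hint` ROW, AND WITH THE MEASURABILITY ROW `hgm` REDUCED TO DATA ROWS:
# the Stage-13 editions `_of_laws` ∕ `_of_rows` of dag-n11-d's `…N11TStepBranchSumAtRecord13` (p620817)

HEADER — WORK-UNIT METADATA.  Cell `pub-ymgap`, YM-PLAN Track A (HUMAN RULING D-0062 ∕ D-0149), width seat `pub-ymgap-dag-n11-w2` (g4; WIDTH SEAT 2∕4 on N11 [B14]),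
route `BalabanUVNodes`; this seat's jail key is K1⁷ `stmt-QuantumFields-20542` (`--kind proof --supports 20542 --as helper`, count-neutral); the K1 face of record since
KEY MAP v2 is K1⁹ `StabilityBRunRowsAtRecordR13SepCoPHV` = stmt-QuantumFields-27364 (MIS-KEY ∕ VALID rule R463 (4)(a): lineage BY NAME).  [III] = [Balaban1988Convergent].
Sequel of this seat's g3 files p622291 `…N11KernelRTSectionIntegrable` and p624357 `…N11TStepInnerIntegrandGraphIntegrable` (★★★ `slotsTOfRecord_succ_ae_eq_TkOfRecord_succ_of_innerSum_of_laws`: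
dag-n11-d's identity of (O3′) on the nose with the conditional-integrability row `hint` REPLACED by joint measurability `hgm` + the weight LAWS + a nonnegative operand),
over dag-n11-d's `…N11TkOpMeasurable` (p-g10: `measurable_zetaOp`, `measurable_aOp`, `measurable_tkOp`, `measurable_baseCfg`, `measurable_genOp_genDataOfRecord`,
`measurable_tkWeightsOfRecordP_ζ ∕ _w`),
def-T v1.7 `Node00/Record13CoPH` (`Stage13HParams`, `WtOfRecord₁₃H`, `WtOfRecord₁₃H_laws`, `Stage13HParams.rzAt`), `Node00/Record13CoP` (`UbgOfRecord₁₃CoP`), `Node00/Record13`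
(`settingOfRecord₁₃`) and `Node00/Sect2FormOfRecord` (`sect2Operand`, `sect2Operand_pos`, `sect2Slot`).  Bus: CLAIM-1 of g4 (INBOX l.36109).

WHY THIS FILE.  dag-n11-d's p620817 ★★★★★★ `slotsTOfRecord₁₃H_succ_ae_eq_sect2Slot_of_innerSum` reads the (O3′) identity `slotsTOfRecord … (k+1) s′ =ᵐ[dV′] sect2Slot …
(WtOfRecord₁₃H θ p s′) s′ t′ E′ (UbgOfRecord₁₃CoP … (k+1) s′)` modulo FOUR displayed rows `hG` ∕ `hin` ∕ `hint` ∕ `hinnerSum`.  The row `hint` (conditional integrability of the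
`{S_j}`-indexed inside integrands against the conditional law of the averaging fibre) is REDUNDANT: the inside integrands `ζ·(aOp k sA w (𝐓_k(s′,S) e^{A_{k+1}}))` are NONNEGATIVE
under 11a's weight laws (the core proviso row `zhLaws`, via `WtOfRecord₁₃H_laws`) since the operand is an exponential (`sect2Operand_pos`), so p624357 §3 applies as soon as the
explicit integrands are jointly MEASURABLE (`hgm`).  And `hgm` itself is bookkeeping: 11a's operator algebra preserves measurability (`…N11TkOpMeasurable`), so it follows from
the measurability of the residual serving `s′` (`ζ0_j(Y)`, `quad_j(Λ′)` — two conjuncts of dag-n11-e's `ResidualRowsAt` shape) and of the operand on the multiscale configuration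
space (the first conjunct of `OperandRowsAt`'s shape, here at `(k+1, s′)`; itself a consequence of three term rows of `t′` by dag-n11-d's `measurable_sect2Operand_of_termRows` and
`measurable_UbgOfRecord₁₃CoP`).  NET for the (O3′) producer at a 𝐓-present expansion child: the displayed rows are `hG` (def-T's graph integrability), `hin` (the inner reading),
`hinnerSum` (THE CHARTED INNER SUM — [I] §2 ∕ [III] §3 ∕ Thm 2, untouched), the core row `zhLaws`, two residual-measurability rows and one operand row.  NO conditional-integrability
row and NO joint-measurability row of composite integrands remain.

WHAT THIS FILE PROVES (0 `sorry`, 0 `def`, standard axioms).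
§1 (generic weights `W`, fluctuation space `V`, operand `Φ`): `measurable_glueUpdate_baseCfg` (the insertion `x ↦ update (baseCfg (k+1) (e.symm x.1)) k (updateFinset (·)|_{sV} x.2, ·)`
of the level-`(k+1)` skew coordinates and the level-`k` bond variables into 11a's base configuration is measurable), ★ `measurable_innerIntegrand_of_weights` (the explicit
inside integrand `ζ·(aOp k sA w (𝐓_k(s′,S)Φ))` composed with it is jointly measurable for measurable `W.ζ`, `W.w`, `Φ` — the SHAPE of the `hgm` row).
§2 (Record 13): ★★ `hgm_at_record₁₃_of_rows` (p620817's ∕ p624357 §3's `hgm` row at `W := WtOfRecord₁₃H θ p s′` and the operand `e^{A_{k+1}(s′; t′, E′, U_{k+1})}` FROM the two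
residual-measurability rows + the operand row; the operand row itself follows from three term rows of `t′` by dag-n11-d's `measurable_sect2Operand_of_termRows` +
`…N11BackgroundCoPMeasurable.measurable_UbgOfRecord₁₃CoP` — not re-typed here).
§3 ★★★ `slotsTOfRecord₁₃H_succ_ae_eq_sect2Slot_of_innerSum_of_laws` (p620817's ★★★★★★ with `hint` REPLACED by `hgm` + `zhLaws`), ★★★ `slotsTOfRecord₁₃H_succ_ae_eq_sect2Slot_of_innerSum_of_rows`
(`hgm` DISCHARGED by §2: `hG` ∕ `hin` ∕ `hinnerSum` + `zhLaws` + two residual rows + one operand row), ★★★ `slotsTOfRecord₁₃H_succ_O3_of_innerSum_of_rows` (the (O3′) DISJUNCTION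
of dag-n11-e's `…N11Sect3SupplyChainDefs.PresentChildObligations` VERBATIM — right disjunct, `χ_{k+1}`-guard dropped — from the same rows).

HONEST FRAMING.  Helper lane, count-neutral; [folklore] measurability ∕ positivity bookkeeping over def-T's ∕ 11a's OWN objects and landed lemmas BY NAME; nothing of p619836 ∕
p620817 ∕ p622291 ∕ p624357 re-typed.  `hG` ∕ `hin` ∕ `hinnerSum` DISPLAYED (no claim that any witness satisfies them); NO chart of Bałaban's, NO Jacobian, NO Gaussian integration,
nothing of [I] §2 ∕ [III] §3 ∕ Thm 2 asserted; (B4) ∕ (S-α) ∕ (O3′) NOT closed; N11 NOT discharged; K1⁹ NOT closed, no registered stub touched; counts unmoved (typed 28∕28 ·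
discharged 5∕27 · A 5∕28).  One finite `𝕋⁴_{L^K}` programme at fixed `ε = L^{−K}`; R4 closes only the conditional finite-𝕋⁴ rung `BalabanLadder.UV` — NOT ℝ⁴, NOT OS, NOT a
mass gap, NOT Clay.  No `sorry`, `axiom`, `def`, `instance`, `notation`.  Sources (SHAPE ∕ bookkeeping only): [III] (2.18) p.257, (2.20)–(2.21) p.258, (2.23) p.258, (3.1) p.264,
(3.16)–(3.23) pp.268–270, (3.24)–(3.25) p.270, §3 p.279, Thm 2 p.263.
-/

noncomputable section

open MeasureTheory ProbabilityTheory
open scoped ENNReal NNReal BigOperators Matrix.Norms.L2Operator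

namespace Summit.QuantumFields.YangMills.Theorems.BalabanUVNodesN11TStepBranchSumAtRecord13OfLaws

open Literature.MathematicalPhysics.QuantumFieldTheory.Balaban1983to89
open Literature.MathematicalPhysics.QuantumFieldTheory.Balaban1983to89.T4AveragingDisintegration
open BalabanUVNodesN11TkOpMeasurable (measurable_zetaOp measurable_aOp measurable_tkOp measurable_baseCfg measurable_genOp_genDataOfRecord
  measurable_tkWeightsOfRecordP_ζ measurable_tkWeightsOfRecordP_w)
open BalabanUVNodesN11TStepInnerIntegrandGraphIntegrable (slotsTOfRecord_succ_ae_eq_TkOfRecord_succ_of_innerSum_of_laws)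
open Node00 hiding SU
open Node00.Tk T4Continuum
open B10Eq42TorusConstraint (bondsIn)

/-! ## §1  The explicit inside integrand read through the glue insertion is jointly measurable (generic weights and operand) -/

section Generic

variable (F : T4Family) (N : ℕ) [NeZero N] (V : Type) [NormedAddCommGroup V] [InnerProductSpace ℝ V] [FiniteDimensional ℝ V]
  [MeasurableSpace V] [BorelSpace V]

omit [NeZero N] [InnerProductSpace ℝ V] [FiniteDimensional ℝ V] [BorelSpace V] in
/-- **THE GLUE INSERTION INTO 11a's BASE CONFIGURATION IS MEASURABLE**: `x = ((V′|_{sV′}, V′|_{sV′ᶜ}), y) ↦` the base configuration of the glued level-`(k+1)` field, updated at scale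
`k` by the bond variables `y` on `sV` (`measurable_baseCfg`, `MeasurableEquiv.piEquivPiSubtypeProd`, Mathlib's `measurable_update'` ∕ `measurable_updateFinset'`).
[cite: Balaban1988Convergent, (2.18) p.257, (2.21) p.258 (bookkeeping)] -/
theorem measurable_glueUpdate_baseCfg (K k : ℕ) {hdec : DecidableEq (PBond (F.P K) k)} {hdec' : DecidableEq (PBond (F.P K) (k + 1))}
    (sV : Finset (PBond (F.P K) k)) (sV' : Finset (PBond (F.P K) (k + 1))) :
    Measurable fun x : ((↥sV' → SU N) × ({c : PBond (F.P K) (k + 1) // c ∉ sV'} → SU N)) × (↥sV → SU N) =>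
      Function.update (baseCfg (V := V) (k + 1) ((MeasurableEquiv.piEquivPiSubtypeProd (fun _ : PBond (F.P K) (k + 1) => SU N) (· ∈ sV')).symm x.1)) k
        (Function.updateFinset ((baseCfg (V := V) (k + 1) ((MeasurableEquiv.piEquivPiSubtypeProd (fun _ : PBond (F.P K) (k + 1) => SU N) (· ∈ sV')).symm x.1)) k).1 sV x.2,
          ((baseCfg (V := V) (k + 1) ((MeasurableEquiv.piEquivPiSubtypeProd (fun _ : PBond (F.P K) (k + 1) => SU N) (· ∈ sV')).symm x.1)) k).2) := by
  have hb : Measurable fun x : ((↥sV' → SU N) × ({c : PBond (F.P K) (k + 1) // c ∉ sV'} → SU N)) × (↥sV → SU N) =>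
      baseCfg (P := F.P K) (G := SU N) (V := V) (k + 1)
        ((MeasurableEquiv.piEquivPiSubtypeProd (fun _ : PBond (F.P K) (k + 1) => SU N) (· ∈ sV')).symm x.1) :=
    (measurable_baseCfg (k + 1)).comp ((MeasurableEquiv.measurable _).comp measurable_fst)
  have hk : Measurable fun x : ((↥sV' → SU N) × ({c : PBond (F.P K) (k + 1) // c ∉ sV'} → SU N)) × (↥sV → SU N) =>
      baseCfg (P := F.P K) (G := SU N) (V := V) (k + 1)
        ((MeasurableEquiv.piEquivPiSubtypeProd (fun _ : PBond (F.P K) (k + 1) => SU N) (· ∈ sV')).symm x.1) k :=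
    (measurable_pi_apply k).comp hb
  exact measurable_update'.comp (hb.prodMk
    ((measurable_updateFinset'.comp ((measurable_fst.comp hk).prodMk measurable_snd)).prodMk (measurable_snd.comp hk)))

/-- ★ **THE EXPLICIT INSIDE INTEGRAND OF THE BRANCH-SUM JUNCTION IS JOINTLY MEASURABLE — THE SHAPE OF THE `hgm` ROW** (p622291 ∕ p624357 ∕ p620817): for a weight datum `W`
with measurable `ζ_j(Y)` and `w_j(Λ′, Y, S)`, any history `s′` of length `k+1`, branch `S` and measurable operand `Φ`, the integrand `x ↦ ζ_k(ω_x)·(aOp k sA_k w_k (𝐓_k(s′,S)Φ))(ω_x)`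
at `ω_x =` the glue insertion of §1 is measurable (`measurable_zetaOp` ∕ `measurable_aOp` ∕ `measurable_tkOp` ∕ `measurable_genOp_genDataOfRecord` BY NAME, composed with
`measurable_glueUpdate_baseCfg`). [cite: Balaban1988Convergent, (2.18) p.257, (2.20)–(2.21) p.258, (3.23)–(3.24) p.270 (bookkeeping)] -/
theorem measurable_innerIntegrand_of_weights (ν : Stage7Numerics) (M : ℕ) (g : ℕ → ℝ) (K : ℕ) (W : TkWeights F N V K)
    (hζ : ∀ j Y, Measurable (W.ζ j Y)) (hw : ∀ j Λ' Y S, Measurable (W.w j Λ' Y S))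
    {k : ℕ} {hdec : DecidableEq (PBond (F.P K) k)} {hdec' : DecidableEq (PBond (F.P K) (k + 1))}
    (s' : SeqOfRecord F ν M g K (k + 1)) (S : ℕ → Set (Site (F.P K) 0)) {Φ : MultiCfg (F.P K) (SU N) V → ℝ} (hΦ : Measurable Φ)
    (sV : Finset (PBond (F.P K) k)) (sV' : Finset (PBond (F.P K) (k + 1))) :
    Measurable fun x : ((↥sV' → SU N) × ({c : PBond (F.P K) (k + 1) // c ∉ sV'} → SU N)) × (↥sV → SU N) =>
      zetaOp (genDataOfRecord F N V ν M g K W s' S k).ζ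
        (aOp k (genDataOfRecord F N V ν M g K W s' S k).sA (genDataOfRecord F N V ν M g K W s' S k).w (tkBranchOfRecord F N V ν M g K W s' S k Φ))
        (Function.update (baseCfg (k + 1) ((MeasurableEquiv.piEquivPiSubtypeProd (fun _ : PBond (F.P K) (k + 1) => SU N) (· ∈ sV')).symm x.1)) k
          (Function.updateFinset ((baseCfg (V := V) (k + 1) ((MeasurableEquiv.piEquivPiSubtypeProd (fun _ : PBond (F.P K) (k + 1) => SU N) (· ∈ sV')).symm x.1)) k).1
              sV x.2,
            ((baseCfg (V := V) (k + 1) ((MeasurableEquiv.piEquivPiSubtypeProd (fun _ : PBond (F.P K) (k + 1) => SU N) (· ∈ sV')).symm x.1)) k).2)) := by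
  -- the branch operator `𝐓_k(s′, S)Φ` is measurable on the all-scales configuration (11a's ordered product of measurable generations)
  have hT : Measurable (tkBranchOfRecord F N V ν M g K W s' S k Φ) := by
    unfold tkBranchOfRecord
    exact measurable_tkOp _ (fun j Ψ hΨ => measurable_genOp_genDataOfRecord F N V ν M g K W s' S j (hζ j _) (hw j _ _ _) hΨ) k hΦ
  have hz : Measurable (genDataOfRecord F N V ν M g K W s' S k).ζ := hζ k _
  have hwk : Measurable (genDataOfRecord F N V ν M g K W s' S k).w := hw k _ _ _
  exact (measurable_zetaOp hz (measurable_aOp k _ hwk hT)).comp (measurable_glueUpdate_baseCfg F N V K k sV sV')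

end Generic

/-! ## §2  The `hgm` row at the Stage-13 letters from the residual-measurability rows and the operand row -/

section Record

variable {F : T4Family} {N : ℕ} [NeZero N]

/-- ★★ **THE `hgm` ROW OF p620817 ∕ p624357 §3 AT THE STAGE-13 LETTERS, FROM ROWS**: at `θ : Stage13HParams`, run `p`, history `s′` of length `k+1` and ANY proposed `(t′, E′)`,
if the residual serving `s′` has measurable `ζ0_j(Y)` and `quad_j(Λ′)` (the measurability conjuncts of dag-n11-e's `ResidualRowsAt` shape) and the operand
`ω ↦ e^{A_{k+1}(s′; t′, E′, U_{k+1}(𝐖(ω)))}` is measurable on the multiscale configuration space for every admissible branch (the first conjunct of `OperandRowsAt`'s shape, at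
`(k+1, s′)`), then every `{S_j}`-indexed explicit inside integrand of the NEW operand, read through the glue insertion, is jointly measurable.  §1 at `W := WtOfRecord₁₃H θ p s′`
(`measurable_tkWeightsOfRecordP_ζ ∕ _w`; `WtOfRecord₁₃H` IS 12a″'s `tkWeightsOfRecordP` over `θ.zhAt p s′`). [cite: Balaban1988Convergent, (2.18) p.257, (2.20)–(2.23) p.258, (3.16)–(3.24) pp.268–270 (bookkeeping)] -/
theorem hgm_at_record₁₃_of_rows (θ : Stage13HParams F N) (p : B12.RunParams) {k : ℕ}
    {hdec : DecidableEq (PBond (F.P p.K) k)} {hdec' : DecidableEq (PBond (F.P p.K) (k + 1))}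
    (s' : SeqOfRecord F θ.ν θ.τ9.M (gOfRecord₁₃ F N θ.toStage13Params p) p.K (k + 1))
    (t' : Sect2.TermValues (F.P p.K) (MatA N) (FluctV N) θ.τ9.M) (E' : ℝ)
    (hζ : ∀ (j : ℕ) (Y : Set (Site (F.P p.K) 0)), Measurable ((θ.zhAt p s').ζ0 j Y))
    (hq : ∀ (j : ℕ) (Λ' : Set (Site (F.P p.K) 0)), Measurable ((θ.zhAt p s').quad j Λ'))
    (hΦm : ∀ S ∈ admSOfRecord F θ.ν θ.τ9.M (gOfRecord₁₃ F N θ.toStage13Params p) p.K (k + 1) s',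
      Measurable (fun ω : MultiCfg (F.P p.K) (SU N) (FluctV N) =>
        sect2Operand F N (FluctV N) p.K (settingOfRecord₁₃ F N θ.toStage13Params p) (θ.rzAt p s') s' t' E'
          (UbgOfRecord₁₃CoP F N θ.toStage13Params p (k + 1) s') (S, fun j => (ω j).2) (fun j => (ω j).1))) :
    ∀ S ∈ admSOfRecord F θ.ν θ.τ9.M (gOfRecord₁₃ F N θ.toStage13Params p) p.K (k + 1) s', Measurable fun x :
        ((↥(Set.toFinite (bondsIn (k + 1) (s'.Ω (k + 1))ᶜ)).toFinset → SU N) ×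
            ({c : PBond (F.P p.K) (k + 1) // c ∉ (Set.toFinite (bondsIn (k + 1) (s'.Ω (k + 1))ᶜ)).toFinset} → SU N)) ×
          (↥(Set.toFinite (bondsIn k (s'.Ω (k + 1))ᶜ)).toFinset → SU N) =>
      zetaOp (genDataOfRecord F N (FluctV N) θ.ν θ.τ9.M (gOfRecord₁₃ F N θ.toStage13Params p) p.K (WtOfRecord₁₃H F N θ p s') s' S k).ζ
        (aOp k (genDataOfRecord F N (FluctV N) θ.ν θ.τ9.M (gOfRecord₁₃ F N θ.toStage13Params p) p.K (WtOfRecord₁₃H F N θ p s') s' S k).sA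
          (genDataOfRecord F N (FluctV N) θ.ν θ.τ9.M (gOfRecord₁₃ F N θ.toStage13Params p) p.K (WtOfRecord₁₃H F N θ p s') s' S k).w
          (tkBranchOfRecord F N (FluctV N) θ.ν θ.τ9.M (gOfRecord₁₃ F N θ.toStage13Params p) p.K (WtOfRecord₁₃H F N θ p s') s' S k
            (fun ω => sect2Operand F N (FluctV N) p.K (settingOfRecord₁₃ F N θ.toStage13Params p) (θ.rzAt p s') s' t' E'
              (UbgOfRecord₁₃CoP F N θ.toStage13Params p (k + 1) s') (S, fun j => (ω j).2) (fun j => (ω j).1))))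
        (Function.update (baseCfg (k + 1) ((MeasurableEquiv.piEquivPiSubtypeProd (fun _ : PBond (F.P p.K) (k + 1) => SU N)
            (· ∈ (Set.toFinite (bondsIn (k + 1) (s'.Ω (k + 1))ᶜ)).toFinset)).symm x.1)) k
          (Function.updateFinset ((baseCfg (V := FluctV N) (k + 1) ((MeasurableEquiv.piEquivPiSubtypeProd (fun _ : PBond (F.P p.K) (k + 1) => SU N)
            (· ∈ (Set.toFinite (bondsIn (k + 1) (s'.Ω (k + 1))ᶜ)).toFinset)).symm x.1)) k).1 (Set.toFinite (bondsIn k (s'.Ω (k + 1))ᶜ)).toFinset x.2,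
            ((baseCfg (V := FluctV N) (k + 1) ((MeasurableEquiv.piEquivPiSubtypeProd (fun _ : PBond (F.P p.K) (k + 1) => SU N)
              (· ∈ (Set.toFinite (bondsIn (k + 1) (s'.Ω (k + 1))ᶜ)).toFinset)).symm x.1)) k).2)) :=
  fun S hS => measurable_innerIntegrand_of_weights F N (FluctV N) θ.ν θ.τ9.M (gOfRecord₁₃ F N θ.toStage13Params p) p.K (WtOfRecord₁₃H F N θ p s')
    (fun j Y => measurable_tkWeightsOfRecordP_ζ F N (FluctV N) θ.ν θ.A₁ p (gOfRecord₁₃ F N θ.toStage13Params p) (θ.zhAt p s') j Y (hζ j Y))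
    (fun j Λ' Y S₀ => measurable_tkWeightsOfRecordP_w F N (FluctV N) θ.ν θ.A₁ p (gOfRecord₁₃ F N θ.toStage13Params p) (θ.zhAt p s') j Λ' Y S₀ (hq j Λ'))
    (hdec := hdec) (hdec' := hdec') s' S (hΦm S hS) _ _

end Record

/-! ## §3  (O3′) on the nose in the Stage-13 letters without the `hint` row: `_of_laws` (hgm displayed) and `_of_rows` (hgm discharged); the (O3′) disjunction -/

section OnTheNose

variable {F : T4Family} {N : ℕ} [NeZero N]

/-- ★★★ **(O3′) ON THE NOSE IN THE STAGE-13 LETTERS, `_of_laws` — NO `hint` ROW**: dag-n11-d's p620817 ★★★★★★ `slotsTOfRecord₁₃H_succ_ae_eq_sect2Slot_of_innerSum` with its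
conditional-integrability row `hint` REPLACED by joint measurability `hgm` of the explicit inside integrands and the core proviso row `hZ : ∀ p n Ω Λ, (θ.Zh p n Ω Λ).Laws`
(`zhLaws`): `slotsTOfRecord … (k+1) s′ =ᵐ[dV′] sect2Slot … (WtOfRecord₁₃H θ p s′) s′ t′ E′ (UbgOfRecord₁₃CoP … (k+1) s′)` for ANY `(t′, E′)`, modulo `hG` ∕ `hin` ∕ `hinnerSum` (Stage-13
letters VERBATIM, DISPLAYED).  p624357 §3 at `V := FluctV N`, `W := WtOfRecord₁₃H θ p s′` (laws by `WtOfRecord₁₃H_laws hZ`), `Φ := sect2Operand …` (nonnegative: `sect2Operand_pos`);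
`sect2Slot` is `TkOfRecord … (sect2Operand …)` by `rfl`. [cite: Balaban1988Convergent, (2.18) p.257, (2.20)–(2.21) p.258, (2.23) p.258, (3.24)–(3.25) p.270, §3 p.279] -/
theorem slotsTOfRecord₁₃H_succ_ae_eq_sect2Slot_of_innerSum_of_laws (θ : Stage13HParams F N) (hZ : ∀ p n Ω Λ, (θ.Zh p n Ω Λ).Laws)
    (p : B12.RunParams) {k : ℕ} (hkK : k < p.K)
    {hdec : DecidableEq (PBond (F.P p.K) k)} {hdec' : DecidableEq (PBond (F.P p.K) (k + 1))} (hk : k + 1 ≤ (F.P p.K).m + (F.P p.K).K)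
    (s' : SeqOfRecord F θ.ν θ.τ9.M (gOfRecord₁₃ F N θ.toStage13Params p) p.K (k + 1))
    (t' : Sect2.TermValues (F.P p.K) (MatA N) (FluctV N) θ.τ9.M) (E' : ℝ)
    (hG : Integrable (fun U => wOfRecord₉ F N θ.toStage9Params p (gOfRecord₁₃ F N θ.toStage13Params p) k s' U ((avOfRecord F N p.K k).avg U) *
      (chiSeqOfRecord F N θ.ν θ.τ9.M (gOfRecord₁₃ F N θ.toStage13Params p) p.K k s'.init U *
        slotsOfRecord F N θ.ν θ.τ9 (EOfRecord₁₃ F N θ.toStage13Params) (wOfRecord₉ F N θ.toStage9Params) θ.ppSel p (gOfRecord₁₃ F N θ.toStage13Params p) k s'.init U))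
      (fieldMeasure (F.P p.K) k (SU N)))
    {Fᵢ : (↥(Set.toFinite (bondsIn k (s'.Ω (k + 1))ᶜ)).toFinset → SU N) ×
        ({c : PBond (F.P p.K) (k + 1) // c ∉ (Set.toFinite (bondsIn (k + 1) (s'.Ω (k + 1))ᶜ)).toFinset} → SU N) → ℝ} (hFm : Measurable Fᵢ)
    (hin : kernelTransport
        ((Measure.pi fun _ : ↥(Set.toFinite (bondsIn k (s'.Ω (k + 1))ᶜ)).toFinset => (HaarData.haar : Measure (SU N))).prod
          (Measure.pi fun _ : {b : PBond (F.P p.K) k // b ∉ (Set.toFinite (bondsIn k (s'.Ω (k + 1))ᶜ)).toFinset} => (HaarData.haar : Measure (SU N))))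
        ((Measure.pi fun _ : ↥(Set.toFinite (bondsIn k (s'.Ω (k + 1))ᶜ)).toFinset => (HaarData.haar : Measure (SU N))).prod
          (Measure.pi fun _ : {c : PBond (F.P p.K) (k + 1) // c ∉ (Set.toFinite (bondsIn (k + 1) (s'.Ω (k + 1))ᶜ)).toFinset} =>
            (HaarData.haar : Measure (SU N))))
        (fun q => (q.1, fun c : {c : PBond (F.P p.K) (k + 1) // c ∉ (Set.toFinite (bondsIn (k + 1) (s'.Ω (k + 1))ᶜ)).toFinset} =>
          (avOfRecord F N p.K k).avg
            ((MeasurableEquiv.piEquivPiSubtypeProd (fun _ : PBond (F.P p.K) k => SU N)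
              (· ∈ (Set.toFinite (bondsIn k (s'.Ω (k + 1))ᶜ)).toFinset)).symm q) c))
        ((fun U => wOfRecord₉ F N θ.toStage9Params p (gOfRecord₁₃ F N θ.toStage13Params p) k s' U ((avOfRecord F N p.K k).avg U) *
            (chiSeqOfRecord F N θ.ν θ.τ9.M (gOfRecord₁₃ F N θ.toStage13Params p) p.K k s'.init U *
              slotsOfRecord F N θ.ν θ.τ9 (EOfRecord₁₃ F N θ.toStage13Params) (wOfRecord₉ F N θ.toStage9Params) θ.ppSel p
                (gOfRecord₁₃ F N θ.toStage13Params p) k s'.init U)) ∘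
          ⇑(MeasurableEquiv.piEquivPiSubtypeProd (fun _ : PBond (F.P p.K) k => SU N)
            (· ∈ (Set.toFinite (bondsIn k (s'.Ω (k + 1))ᶜ)).toFinset)).symm)
      =ᵐ[(Measure.pi fun _ : ↥(Set.toFinite (bondsIn k (s'.Ω (k + 1))ᶜ)).toFinset => (HaarData.haar : Measure (SU N))).prod
          (Measure.pi fun _ : {c : PBond (F.P p.K) (k + 1) // c ∉ (Set.toFinite (bondsIn (k + 1) (s'.Ω (k + 1))ᶜ)).toFinset} =>
            (HaarData.haar : Measure (SU N)))] Fᵢ)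
    (hgm : ∀ S ∈ admSOfRecord F θ.ν θ.τ9.M (gOfRecord₁₃ F N θ.toStage13Params p) p.K (k + 1) s', Measurable fun x :
        ((↥(Set.toFinite (bondsIn (k + 1) (s'.Ω (k + 1))ᶜ)).toFinset → SU N) ×
            ({c : PBond (F.P p.K) (k + 1) // c ∉ (Set.toFinite (bondsIn (k + 1) (s'.Ω (k + 1))ᶜ)).toFinset} → SU N)) ×
          (↥(Set.toFinite (bondsIn k (s'.Ω (k + 1))ᶜ)).toFinset → SU N) =>
      zetaOp (genDataOfRecord F N (FluctV N) θ.ν θ.τ9.M (gOfRecord₁₃ F N θ.toStage13Params p) p.K (WtOfRecord₁₃H F N θ p s') s' S k).ζ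
        (aOp k (genDataOfRecord F N (FluctV N) θ.ν θ.τ9.M (gOfRecord₁₃ F N θ.toStage13Params p) p.K (WtOfRecord₁₃H F N θ p s') s' S k).sA
          (genDataOfRecord F N (FluctV N) θ.ν θ.τ9.M (gOfRecord₁₃ F N θ.toStage13Params p) p.K (WtOfRecord₁₃H F N θ p s') s' S k).w
          (tkBranchOfRecord F N (FluctV N) θ.ν θ.τ9.M (gOfRecord₁₃ F N θ.toStage13Params p) p.K (WtOfRecord₁₃H F N θ p s') s' S k
            (fun ω => sect2Operand F N (FluctV N) p.K (settingOfRecord₁₃ F N θ.toStage13Params p) (θ.rzAt p s') s' t' E'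
              (UbgOfRecord₁₃CoP F N θ.toStage13Params p (k + 1) s') (S, fun j => (ω j).2) (fun j => (ω j).1))))
        (Function.update (baseCfg (k + 1) ((MeasurableEquiv.piEquivPiSubtypeProd (fun _ : PBond (F.P p.K) (k + 1) => SU N)
            (· ∈ (Set.toFinite (bondsIn (k + 1) (s'.Ω (k + 1))ᶜ)).toFinset)).symm x.1)) k
          (Function.updateFinset ((baseCfg (V := FluctV N) (k + 1) ((MeasurableEquiv.piEquivPiSubtypeProd (fun _ : PBond (F.P p.K) (k + 1) => SU N)
            (· ∈ (Set.toFinite (bondsIn (k + 1) (s'.Ω (k + 1))ᶜ)).toFinset)).symm x.1)) k).1 (Set.toFinite (bondsIn k (s'.Ω (k + 1))ᶜ)).toFinset x.2,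
            ((baseCfg (V := FluctV N) (k + 1) ((MeasurableEquiv.piEquivPiSubtypeProd (fun _ : PBond (F.P p.K) (k + 1) => SU N)
              (· ∈ (Set.toFinite (bondsIn (k + 1) (s'.Ω (k + 1))ᶜ)).toFinset)).symm x.1)) k).2)))
    (hinnerSum : ∀ᵐ q ∂((Measure.pi fun _ : ↥(Set.toFinite (bondsIn (k + 1) (s'.Ω (k + 1))ᶜ)).toFinset => (HaarData.haar : Measure (SU N))).prod
          (Measure.pi fun _ : {c : PBond (F.P p.K) (k + 1) // c ∉ (Set.toFinite (bondsIn (k + 1) (s'.Ω (k + 1))ᶜ)).toFinset} =>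
            (HaarData.haar : Measure (SU N)))),
      ∀ y : ↥(Set.toFinite (bondsIn k (s'.Ω (k + 1))ᶜ)).toFinset → SU N,
        avgRestrOfRecord F N p.K k (Set.toFinite (bondsIn k (s'.Ω (k + 1))ᶜ)).toFinset (Set.toFinite (bondsIn (k + 1) (s'.Ω (k + 1))ᶜ)).toFinset y = q.1 →
        Fᵢ (y, q.2) =
          ∑ S ∈ admSOfRecord F θ.ν θ.τ9.M (gOfRecord₁₃ F N θ.toStage13Params p) p.K (k + 1) s',
            zetaOp (genDataOfRecord F N (FluctV N) θ.ν θ.τ9.M (gOfRecord₁₃ F N θ.toStage13Params p) p.K (WtOfRecord₁₃H F N θ p s') s' S k).ζ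
              (aOp k (genDataOfRecord F N (FluctV N) θ.ν θ.τ9.M (gOfRecord₁₃ F N θ.toStage13Params p) p.K (WtOfRecord₁₃H F N θ p s') s' S k).sA
                (genDataOfRecord F N (FluctV N) θ.ν θ.τ9.M (gOfRecord₁₃ F N θ.toStage13Params p) p.K (WtOfRecord₁₃H F N θ p s') s' S k).w
                (tkBranchOfRecord F N (FluctV N) θ.ν θ.τ9.M (gOfRecord₁₃ F N θ.toStage13Params p) p.K (WtOfRecord₁₃H F N θ p s') s' S k
                  (fun ω => sect2Operand F N (FluctV N) p.K (settingOfRecord₁₃ F N θ.toStage13Params p) (θ.rzAt p s') s' t' E'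
                    (UbgOfRecord₁₃CoP F N θ.toStage13Params p (k + 1) s') (S, fun j => (ω j).2) (fun j => (ω j).1))))
              (Function.update (baseCfg (k + 1) ((MeasurableEquiv.piEquivPiSubtypeProd (fun _ : PBond (F.P p.K) (k + 1) => SU N)
                  (· ∈ (Set.toFinite (bondsIn (k + 1) (s'.Ω (k + 1))ᶜ)).toFinset)).symm q)) k
                (Function.updateFinset ((baseCfg (V := FluctV N) (k + 1) ((MeasurableEquiv.piEquivPiSubtypeProd (fun _ : PBond (F.P p.K) (k + 1) => SU N)
                  (· ∈ (Set.toFinite (bondsIn (k + 1) (s'.Ω (k + 1))ᶜ)).toFinset)).symm q)) k).1 (Set.toFinite (bondsIn k (s'.Ω (k + 1))ᶜ)).toFinset y,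
                  ((baseCfg (V := FluctV N) (k + 1) ((MeasurableEquiv.piEquivPiSubtypeProd (fun _ : PBond (F.P p.K) (k + 1) => SU N)
                    (· ∈ (Set.toFinite (bondsIn (k + 1) (s'.Ω (k + 1))ᶜ)).toFinset)).symm q)) k).2))) :
    slotsTOfRecord F N θ.ν θ.τ9 (EOfRecord₁₃ F N θ.toStage13Params) (wOfRecord₉ F N θ.toStage9Params) θ.ppSel p (gOfRecord₁₃ F N θ.toStage13Params p) (k + 1) s'
      =ᵐ[fieldMeasure (F.P p.K) (k + 1) (SU N)]
        sect2Slot F N (FluctV N) p.K (settingOfRecord₁₃ F N θ.toStage13Params p) (θ.rzAt p s') (WtOfRecord₁₃H F N θ p s') s' t' E'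
          (UbgOfRecord₁₃CoP F N θ.toStage13Params p (k + 1) s') :=
  slotsTOfRecord_succ_ae_eq_TkOfRecord_succ_of_innerSum_of_laws θ.ν θ.τ9 (EOfRecord₁₃ F N θ.toStage13Params) (wOfRecord₉ F N θ.toStage9Params) θ.ppSel p
    (gOfRecord₁₃ F N θ.toStage13Params p) hkK (hdec := hdec) (hdec' := hdec') hk s' (WtOfRecord₁₃H F N θ p s')
    (sect2Operand F N (FluctV N) p.K (settingOfRecord₁₃ F N θ.toStage13Params p) (θ.rzAt p s') s' t' E' (UbgOfRecord₁₃CoP F N θ.toStage13Params p (k + 1) s'))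
    hG hFm hin hgm (WtOfRecord₁₃H_laws hZ p s')
    (fun S _ ω => (sect2Operand_pos p.K _ _ s' t' E' _ (S, fun j => (ω j).2) (fun j => (ω j).1)).le) hinnerSum

/-- ★★★ **(O3′) ON THE NOSE IN THE STAGE-13 LETTERS, `_of_rows` — NO `hint`, NO `hgm`**: as `…_of_laws`, the joint-measurability row `hgm` DISCHARGED by §2 from the two
residual-measurability rows `hζ` ∕ `hq` (the residual serving `s′`) and the operand row `hΦm` (per admissible branch).  Displayed: `hG` ∕ `hin` ∕ `hinnerSum` (THE CHARTED INNER SUM —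
[I] §2 ∕ [III] §3 ∕ Thm 2 — untouched), `zhLaws`, `hζ`, `hq`, `hΦm`. [cite: Balaban1988Convergent, (2.18) p.257, (2.20)–(2.23) p.258, (3.16)–(3.25) pp.268–270, §3 p.279] -/
theorem slotsTOfRecord₁₃H_succ_ae_eq_sect2Slot_of_innerSum_of_rows (θ : Stage13HParams F N) (hZ : ∀ p n Ω Λ, (θ.Zh p n Ω Λ).Laws)
    (p : B12.RunParams) {k : ℕ} (hkK : k < p.K)
    {hdec : DecidableEq (PBond (F.P p.K) k)} {hdec' : DecidableEq (PBond (F.P p.K) (k + 1))} (hk : k + 1 ≤ (F.P p.K).m + (F.P p.K).K)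
    (s' : SeqOfRecord F θ.ν θ.τ9.M (gOfRecord₁₃ F N θ.toStage13Params p) p.K (k + 1))
    (t' : Sect2.TermValues (F.P p.K) (MatA N) (FluctV N) θ.τ9.M) (E' : ℝ)
    (hζ : ∀ (j : ℕ) (Y : Set (Site (F.P p.K) 0)), Measurable ((θ.zhAt p s').ζ0 j Y))
    (hq : ∀ (j : ℕ) (Λ' : Set (Site (F.P p.K) 0)), Measurable ((θ.zhAt p s').quad j Λ'))
    (hΦm : ∀ S ∈ admSOfRecord F θ.ν θ.τ9.M (gOfRecord₁₃ F N θ.toStage13Params p) p.K (k + 1) s',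
      Measurable (fun ω : MultiCfg (F.P p.K) (SU N) (FluctV N) =>
        sect2Operand F N (FluctV N) p.K (settingOfRecord₁₃ F N θ.toStage13Params p) (θ.rzAt p s') s' t' E'
          (UbgOfRecord₁₃CoP F N θ.toStage13Params p (k + 1) s') (S, fun j => (ω j).2) (fun j => (ω j).1)))
    (hG : Integrable (fun U => wOfRecord₉ F N θ.toStage9Params p (gOfRecord₁₃ F N θ.toStage13Params p) k s' U ((avOfRecord F N p.K k).avg U) *
      (chiSeqOfRecord F N θ.ν θ.τ9.M (gOfRecord₁₃ F N θ.toStage13Params p) p.K k s'.init U *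
        slotsOfRecord F N θ.ν θ.τ9 (EOfRecord₁₃ F N θ.toStage13Params) (wOfRecord₉ F N θ.toStage9Params) θ.ppSel p (gOfRecord₁₃ F N θ.toStage13Params p) k s'.init U))
      (fieldMeasure (F.P p.K) k (SU N)))
    {Fᵢ : (↥(Set.toFinite (bondsIn k (s'.Ω (k + 1))ᶜ)).toFinset → SU N) ×
        ({c : PBond (F.P p.K) (k + 1) // c ∉ (Set.toFinite (bondsIn (k + 1) (s'.Ω (k + 1))ᶜ)).toFinset} → SU N) → ℝ} (hFm : Measurable Fᵢ)
    (hin : kernelTransport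
        ((Measure.pi fun _ : ↥(Set.toFinite (bondsIn k (s'.Ω (k + 1))ᶜ)).toFinset => (HaarData.haar : Measure (SU N))).prod
          (Measure.pi fun _ : {b : PBond (F.P p.K) k // b ∉ (Set.toFinite (bondsIn k (s'.Ω (k + 1))ᶜ)).toFinset} => (HaarData.haar : Measure (SU N))))
        ((Measure.pi fun _ : ↥(Set.toFinite (bondsIn k (s'.Ω (k + 1))ᶜ)).toFinset => (HaarData.haar : Measure (SU N))).prod
          (Measure.pi fun _ : {c : PBond (F.P p.K) (k + 1) // c ∉ (Set.toFinite (bondsIn (k + 1) (s'.Ω (k + 1))ᶜ)).toFinset} =>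
            (HaarData.haar : Measure (SU N))))
        (fun q => (q.1, fun c : {c : PBond (F.P p.K) (k + 1) // c ∉ (Set.toFinite (bondsIn (k + 1) (s'.Ω (k + 1))ᶜ)).toFinset} =>
          (avOfRecord F N p.K k).avg
            ((MeasurableEquiv.piEquivPiSubtypeProd (fun _ : PBond (F.P p.K) k => SU N)
              (· ∈ (Set.toFinite (bondsIn k (s'.Ω (k + 1))ᶜ)).toFinset)).symm q) c))
        ((fun U => wOfRecord₉ F N θ.toStage9Params p (gOfRecord₁₃ F N θ.toStage13Params p) k s' U ((avOfRecord F N p.K k).avg U) *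
            (chiSeqOfRecord F N θ.ν θ.τ9.M (gOfRecord₁₃ F N θ.toStage13Params p) p.K k s'.init U *
              slotsOfRecord F N θ.ν θ.τ9 (EOfRecord₁₃ F N θ.toStage13Params) (wOfRecord₉ F N θ.toStage9Params) θ.ppSel p
                (gOfRecord₁₃ F N θ.toStage13Params p) k s'.init U)) ∘
          ⇑(MeasurableEquiv.piEquivPiSubtypeProd (fun _ : PBond (F.P p.K) k => SU N)
            (· ∈ (Set.toFinite (bondsIn k (s'.Ω (k + 1))ᶜ)).toFinset)).symm)
      =ᵐ[(Measure.pi fun _ : ↥(Set.toFinite (bondsIn k (s'.Ω (k + 1))ᶜ)).toFinset => (HaarData.haar : Measure (SU N))).prod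
          (Measure.pi fun _ : {c : PBond (F.P p.K) (k + 1) // c ∉ (Set.toFinite (bondsIn (k + 1) (s'.Ω (k + 1))ᶜ)).toFinset} =>
            (HaarData.haar : Measure (SU N)))] Fᵢ)
    (hinnerSum : ∀ᵐ q ∂((Measure.pi fun _ : ↥(Set.toFinite (bondsIn (k + 1) (s'.Ω (k + 1))ᶜ)).toFinset => (HaarData.haar : Measure (SU N))).prod
          (Measure.pi fun _ : {c : PBond (F.P p.K) (k + 1) // c ∉ (Set.toFinite (bondsIn (k + 1) (s'.Ω (k + 1))ᶜ)).toFinset} =>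
            (HaarData.haar : Measure (SU N)))),
      ∀ y : ↥(Set.toFinite (bondsIn k (s'.Ω (k + 1))ᶜ)).toFinset → SU N,
        avgRestrOfRecord F N p.K k (Set.toFinite (bondsIn k (s'.Ω (k + 1))ᶜ)).toFinset (Set.toFinite (bondsIn (k + 1) (s'.Ω (k + 1))ᶜ)).toFinset y = q.1 →
        Fᵢ (y, q.2) =
          ∑ S ∈ admSOfRecord F θ.ν θ.τ9.M (gOfRecord₁₃ F N θ.toStage13Params p) p.K (k + 1) s',
            zetaOp (genDataOfRecord F N (FluctV N) θ.ν θ.τ9.M (gOfRecord₁₃ F N θ.toStage13Params p) p.K (WtOfRecord₁₃H F N θ p s') s' S k).ζ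
              (aOp k (genDataOfRecord F N (FluctV N) θ.ν θ.τ9.M (gOfRecord₁₃ F N θ.toStage13Params p) p.K (WtOfRecord₁₃H F N θ p s') s' S k).sA
                (genDataOfRecord F N (FluctV N) θ.ν θ.τ9.M (gOfRecord₁₃ F N θ.toStage13Params p) p.K (WtOfRecord₁₃H F N θ p s') s' S k).w
                (tkBranchOfRecord F N (FluctV N) θ.ν θ.τ9.M (gOfRecord₁₃ F N θ.toStage13Params p) p.K (WtOfRecord₁₃H F N θ p s') s' S k
                  (fun ω => sect2Operand F N (FluctV N) p.K (settingOfRecord₁₃ F N θ.toStage13Params p) (θ.rzAt p s') s' t' E'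
                    (UbgOfRecord₁₃CoP F N θ.toStage13Params p (k + 1) s') (S, fun j => (ω j).2) (fun j => (ω j).1))))
              (Function.update (baseCfg (k + 1) ((MeasurableEquiv.piEquivPiSubtypeProd (fun _ : PBond (F.P p.K) (k + 1) => SU N)
                  (· ∈ (Set.toFinite (bondsIn (k + 1) (s'.Ω (k + 1))ᶜ)).toFinset)).symm q)) k
                (Function.updateFinset ((baseCfg (V := FluctV N) (k + 1) ((MeasurableEquiv.piEquivPiSubtypeProd (fun _ : PBond (F.P p.K) (k + 1) => SU N)
                  (· ∈ (Set.toFinite (bondsIn (k + 1) (s'.Ω (k + 1))ᶜ)).toFinset)).symm q)) k).1 (Set.toFinite (bondsIn k (s'.Ω (k + 1))ᶜ)).toFinset y,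
                  ((baseCfg (V := FluctV N) (k + 1) ((MeasurableEquiv.piEquivPiSubtypeProd (fun _ : PBond (F.P p.K) (k + 1) => SU N)
                    (· ∈ (Set.toFinite (bondsIn (k + 1) (s'.Ω (k + 1))ᶜ)).toFinset)).symm q)) k).2))) :
    slotsTOfRecord F N θ.ν θ.τ9 (EOfRecord₁₃ F N θ.toStage13Params) (wOfRecord₉ F N θ.toStage9Params) θ.ppSel p (gOfRecord₁₃ F N θ.toStage13Params p) (k + 1) s'
      =ᵐ[fieldMeasure (F.P p.K) (k + 1) (SU N)]
        sect2Slot F N (FluctV N) p.K (settingOfRecord₁₃ F N θ.toStage13Params p) (θ.rzAt p s') (WtOfRecord₁₃H F N θ p s') s' t' E'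
          (UbgOfRecord₁₃CoP F N θ.toStage13Params p (k + 1) s') :=
  slotsTOfRecord₁₃H_succ_ae_eq_sect2Slot_of_innerSum_of_laws θ hZ p hkK (hdec := hdec) (hdec' := hdec') hk s' t' E' hG hFm hin
    (hgm_at_record₁₃_of_rows θ p (hdec := hdec) (hdec' := hdec') s' t' E' hζ hq hΦm) hinnerSum

/-- ★★★ **THE (O3′) DISJUNCTION OF `PresentChildObligations`, VERBATIM, FROM THE ROWS — NO `hint`, NO `hgm`**: the last conjunct of dag-n11-e's
`…N11Sect3SupplyChainDefs.PresentChildObligations θ p k t tnew EkN s′` (with `t′ := graftAboveB k (t s′.init) (tnew s′)`, `E′ := EkN s′`; ANY `(t′, E′)` here) — right disjunct, the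
`χ_{k+1}(s′)`-guard dropped — from `hG`, `hin`, `hinnerSum`, the core row `zhLaws`, the two residual-measurability rows and the operand row.  p620817's ★★★
`slotsTOfRecord₁₃H_succ_O3_of_innerSum` without `hint`. [cite: Balaban1988Convergent, Thm 2 p.263, §3 p.279, (3.24)–(3.25) p.270] -/
theorem slotsTOfRecord₁₃H_succ_O3_of_innerSum_of_rows (θ : Stage13HParams F N) (hZ : ∀ p n Ω Λ, (θ.Zh p n Ω Λ).Laws)
    (p : B12.RunParams) {k : ℕ} (hkK : k < p.K)
    {hdec : DecidableEq (PBond (F.P p.K) k)} {hdec' : DecidableEq (PBond (F.P p.K) (k + 1))} (hk : k + 1 ≤ (F.P p.K).m + (F.P p.K).K)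
    (s' : SeqOfRecord F θ.ν θ.τ9.M (gOfRecord₁₃ F N θ.toStage13Params p) p.K (k + 1))
    (t' : Sect2.TermValues (F.P p.K) (MatA N) (FluctV N) θ.τ9.M) (E' : ℝ)
    (hζ : ∀ (j : ℕ) (Y : Set (Site (F.P p.K) 0)), Measurable ((θ.zhAt p s').ζ0 j Y))
    (hq : ∀ (j : ℕ) (Λ' : Set (Site (F.P p.K) 0)), Measurable ((θ.zhAt p s').quad j Λ'))
    (hΦm : ∀ S ∈ admSOfRecord F θ.ν θ.τ9.M (gOfRecord₁₃ F N θ.toStage13Params p) p.K (k + 1) s',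
      Measurable (fun ω : MultiCfg (F.P p.K) (SU N) (FluctV N) =>
        sect2Operand F N (FluctV N) p.K (settingOfRecord₁₃ F N θ.toStage13Params p) (θ.rzAt p s') s' t' E'
          (UbgOfRecord₁₃CoP F N θ.toStage13Params p (k + 1) s') (S, fun j => (ω j).2) (fun j => (ω j).1)))
    (hG : Integrable (fun U => wOfRecord₉ F N θ.toStage9Params p (gOfRecord₁₃ F N θ.toStage13Params p) k s' U ((avOfRecord F N p.K k).avg U) *
      (chiSeqOfRecord F N θ.ν θ.τ9.M (gOfRecord₁₃ F N θ.toStage13Params p) p.K k s'.init U *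
        slotsOfRecord F N θ.ν θ.τ9 (EOfRecord₁₃ F N θ.toStage13Params) (wOfRecord₉ F N θ.toStage9Params) θ.ppSel p (gOfRecord₁₃ F N θ.toStage13Params p) k s'.init U))
      (fieldMeasure (F.P p.K) k (SU N)))
    {Fᵢ : (↥(Set.toFinite (bondsIn k (s'.Ω (k + 1))ᶜ)).toFinset → SU N) ×
        ({c : PBond (F.P p.K) (k + 1) // c ∉ (Set.toFinite (bondsIn (k + 1) (s'.Ω (k + 1))ᶜ)).toFinset} → SU N) → ℝ} (hFm : Measurable Fᵢ)
    (hin : kernelTransport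
        ((Measure.pi fun _ : ↥(Set.toFinite (bondsIn k (s'.Ω (k + 1))ᶜ)).toFinset => (HaarData.haar : Measure (SU N))).prod
          (Measure.pi fun _ : {b : PBond (F.P p.K) k // b ∉ (Set.toFinite (bondsIn k (s'.Ω (k + 1))ᶜ)).toFinset} => (HaarData.haar : Measure (SU N))))
        ((Measure.pi fun _ : ↥(Set.toFinite (bondsIn k (s'.Ω (k + 1))ᶜ)).toFinset => (HaarData.haar : Measure (SU N))).prod
          (Measure.pi fun _ : {c : PBond (F.P p.K) (k + 1) // c ∉ (Set.toFinite (bondsIn (k + 1) (s'.Ω (k + 1))ᶜ)).toFinset} =>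
            (HaarData.haar : Measure (SU N))))
        (fun q => (q.1, fun c : {c : PBond (F.P p.K) (k + 1) // c ∉ (Set.toFinite (bondsIn (k + 1) (s'.Ω (k + 1))ᶜ)).toFinset} =>
          (avOfRecord F N p.K k).avg
            ((MeasurableEquiv.piEquivPiSubtypeProd (fun _ : PBond (F.P p.K) k => SU N)
              (· ∈ (Set.toFinite (bondsIn k (s'.Ω (k + 1))ᶜ)).toFinset)).symm q) c))
        ((fun U => wOfRecord₉ F N θ.toStage9Params p (gOfRecord₁₃ F N θ.toStage13Params p) k s' U ((avOfRecord F N p.K k).avg U) *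
            (chiSeqOfRecord F N θ.ν θ.τ9.M (gOfRecord₁₃ F N θ.toStage13Params p) p.K k s'.init U *
              slotsOfRecord F N θ.ν θ.τ9 (EOfRecord₁₃ F N θ.toStage13Params) (wOfRecord₉ F N θ.toStage9Params) θ.ppSel p
                (gOfRecord₁₃ F N θ.toStage13Params p) k s'.init U)) ∘
          ⇑(MeasurableEquiv.piEquivPiSubtypeProd (fun _ : PBond (F.P p.K) k => SU N)
            (· ∈ (Set.toFinite (bondsIn k (s'.Ω (k + 1))ᶜ)).toFinset)).symm)
      =ᵐ[(Measure.pi fun _ : ↥(Set.toFinite (bondsIn k (s'.Ω (k + 1))ᶜ)).toFinset => (HaarData.haar : Measure (SU N))).prod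
          (Measure.pi fun _ : {c : PBond (F.P p.K) (k + 1) // c ∉ (Set.toFinite (bondsIn (k + 1) (s'.Ω (k + 1))ᶜ)).toFinset} =>
            (HaarData.haar : Measure (SU N)))] Fᵢ)
    (hinnerSum : ∀ᵐ q ∂((Measure.pi fun _ : ↥(Set.toFinite (bondsIn (k + 1) (s'.Ω (k + 1))ᶜ)).toFinset => (HaarData.haar : Measure (SU N))).prod
          (Measure.pi fun _ : {c : PBond (F.P p.K) (k + 1) // c ∉ (Set.toFinite (bondsIn (k + 1) (s'.Ω (k + 1))ᶜ)).toFinset} =>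
            (HaarData.haar : Measure (SU N)))),
      ∀ y : ↥(Set.toFinite (bondsIn k (s'.Ω (k + 1))ᶜ)).toFinset → SU N,
        avgRestrOfRecord F N p.K k (Set.toFinite (bondsIn k (s'.Ω (k + 1))ᶜ)).toFinset (Set.toFinite (bondsIn (k + 1) (s'.Ω (k + 1))ᶜ)).toFinset y = q.1 →
        Fᵢ (y, q.2) =
          ∑ S ∈ admSOfRecord F θ.ν θ.τ9.M (gOfRecord₁₃ F N θ.toStage13Params p) p.K (k + 1) s',
            zetaOp (genDataOfRecord F N (FluctV N) θ.ν θ.τ9.M (gOfRecord₁₃ F N θ.toStage13Params p) p.K (WtOfRecord₁₃H F N θ p s') s' S k).ζ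
              (aOp k (genDataOfRecord F N (FluctV N) θ.ν θ.τ9.M (gOfRecord₁₃ F N θ.toStage13Params p) p.K (WtOfRecord₁₃H F N θ p s') s' S k).sA
                (genDataOfRecord F N (FluctV N) θ.ν θ.τ9.M (gOfRecord₁₃ F N θ.toStage13Params p) p.K (WtOfRecord₁₃H F N θ p s') s' S k).w
                (tkBranchOfRecord F N (FluctV N) θ.ν θ.τ9.M (gOfRecord₁₃ F N θ.toStage13Params p) p.K (WtOfRecord₁₃H F N θ p s') s' S k
                  (fun ω => sect2Operand F N (FluctV N) p.K (settingOfRecord₁₃ F N θ.toStage13Params p) (θ.rzAt p s') s' t' E'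
                    (UbgOfRecord₁₃CoP F N θ.toStage13Params p (k + 1) s') (S, fun j => (ω j).2) (fun j => (ω j).1))))
              (Function.update (baseCfg (k + 1) ((MeasurableEquiv.piEquivPiSubtypeProd (fun _ : PBond (F.P p.K) (k + 1) => SU N)
                  (· ∈ (Set.toFinite (bondsIn (k + 1) (s'.Ω (k + 1))ᶜ)).toFinset)).symm q)) k
                (Function.updateFinset ((baseCfg (V := FluctV N) (k + 1) ((MeasurableEquiv.piEquivPiSubtypeProd (fun _ : PBond (F.P p.K) (k + 1) => SU N)
                  (· ∈ (Set.toFinite (bondsIn (k + 1) (s'.Ω (k + 1))ᶜ)).toFinset)).symm q)) k).1 (Set.toFinite (bondsIn k (s'.Ω (k + 1))ᶜ)).toFinset y,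
                  ((baseCfg (V := FluctV N) (k + 1) ((MeasurableEquiv.piEquivPiSubtypeProd (fun _ : PBond (F.P p.K) (k + 1) => SU N)
                    (· ∈ (Set.toFinite (bondsIn (k + 1) (s'.Ω (k + 1))ᶜ)).toFinset)).symm q)) k).2))) :
    slotsTOfRecord F N θ.ν θ.τ9 (EOfRecord₁₃ F N θ.toStage13Params) (wOfRecord₉ F N θ.toStage9Params) θ.ppSel p
        (gOfRecord₁₃ F N θ.toStage13Params p) (k + 1) s' = 0 ∨
      ∀ᵐ V' ∂fieldMeasure (F.P p.K) (k + 1) (SU N),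
        chiSeqOfRecord F N θ.ν θ.τ9.M (gOfRecord₁₃ F N θ.toStage13Params p) p.K (k + 1) s' V' ≠ 0 →
          slotsTOfRecord F N θ.ν θ.τ9 (EOfRecord₁₃ F N θ.toStage13Params) (wOfRecord₉ F N θ.toStage9Params) θ.ppSel p
              (gOfRecord₁₃ F N θ.toStage13Params p) (k + 1) s' V' =
            sect2Slot F N (FluctV N) p.K (settingOfRecord₁₃ F N θ.toStage13Params p) (θ.rzAt p s') (WtOfRecord₁₃H F N θ p s') s' t' E'
              (UbgOfRecord₁₃CoP F N θ.toStage13Params p (k + 1) s') V' :=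
  Or.inr ((slotsTOfRecord₁₃H_succ_ae_eq_sect2Slot_of_innerSum_of_rows θ hZ p hkK (hdec := hdec) (hdec' := hdec') hk s' t' E' hζ hq hΦm hG hFm hin
    hinnerSum).mono fun _ hV' _ => hV')

end OnTheNose

end Summit.QuantumFields.YangMills.Theorems.BalabanUVNodesN11TStepBranchSumAtRecord13OfLaws

end
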